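import Summits.CriticalPhenomena.SAWScalingLimit.Theses.SAWTowerCount
import Summits.CriticalPhenomena.SAWScalingLimit.Theses.SAWConfRestriction
import Summits.CriticalPhenomena.SAWScalingLimit.Theorems.SubseqIdentification.Negative.Necessity
import Summits.CriticalPhenomena.SAWScalingLimit.Theorems.SubseqIdentification.Negative.ProbabilityRedundant
import Literature.Probability.RandomPlanarGeometry.SLEConvergenceCriterion
import Literature.Probability.RandomPlanarGeometry.SAWScalingLimitFamily
import HarnessLib.Audit

/-!
# Crux `ConfCovLimit` (stmt-CriticalPhenomena-0771) — birth skeleton `Lines/birth.lean`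

Route `SAWTowerCount` (rank 6; the crux is SHARED verbatim with `SAWConfRestriction` (rank 2, primary
owner) and `SAWBrownianDomination` (rank 4) — the three `ConfCovLimit` decls have identical bodies).
Crux, BY NAME: `Summit.CriticalPhenomena.SAWScalingLimit.Theses.SAWTowerCount.ConfCovLimit` —
existence AND conformal covariance of the full scaling limit of the critical `δℤ²` SAW:
`∃ P, P.IsChordal ∧ (lim: ∀ D a b, IsEndpointApprox D a b → TendstoLaw (curve) (SAW.law D δ (a δ) (b δ)) id (P D))
∧ (conf: P D' = Φ_* (P D) for every conformal g : D → D' with the right boundary values, Φ|_D = g)`,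
i.e. `∃ P, SAW.IsScalingLimitFamily P ∧ P.IsConformallyCovariant` (`confCovLimit_iff_family`, `Iff` below).

## The line (the owning route's foreseen split, made kernel-checked)

SAWConfRestriction's header, NOT DECOMPOSED YET: "whether r2 should later be SPLIT as EventualTight +
'uniqueness and covariance of subsequential limits'".  This file is that split — the Duminil-Copin–Smirnov
§6 / Billingsley architecture of every printed lattice-to-continuum convergence proof: a family of laws
along the countably generated filter `𝓝[>] 0` converges iff (precompactness) every mesh sequence has a
weakly convergent subsequence and (uniqueness) all such subsequential limits coincide; conformal
covariance is then a property of THE limit.  Three registered stubs, each a genuine OPEN lattice statement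
and each exactly as safe as the crux / the conjunct ((U), (C) are CONSEQUENCES of the crux — proved below,
`subseqLimitsAgree_of_confCovLimit`, `confCovOfLimit_of_confCovLimit`; (T) is NECESSARY for the conjunct
on `ℤ²` — `isTightAlongMesh_of_convergesInLawToSLE_zd`, Cruxes/SubseqIdentification/Disproof.lean §6:
Ulam tightness of the limit law + Urysohn test functions + compact containers of lattice polylines; the
same argument applies verbatim to any probability weak limit, i.e. to the crux's `P D`, not re-proved here):

* `stub_eventualTight` — (T) EVENTUAL TIGHTNESS along the mesh filter of the pushed critical SAW laws,
  for every Dobrushin domain and endpoint approximation; VERBATIM the shared item `EventualTight`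
  (stmt-CriticalPhenomena-1881, `SAWConfRestriction.EventualTight`, shared with a dozen sibling SAW
  routes, own Cruxes/EventualTight directory; `Iff.rfl` pin below).  OPEN: no annulus-crossing / Condition-G2 / RSW
  bound for the `x_c`-SAW in print (KS17 §4 omits SAW; no FKG).  The repaired form of the refuted all-`δ`
  `Tight` (stmt-0772, negatives index) — that statement is NOT used here.
* `stub_subseqLimitsAgree` — (U) UNIQUENESS OF SUBSEQUENTIAL LIMITS (new; the identification input
  proper): for one Dobrushin domain `D`, two endpoint approximations `(a, b)`, `(a', b')`, two mesh
  sequences `s, s' → 0⁺` and two probability weak limits `ν, ν'` of the corresponding pushed critical SAW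
  laws, `ν = ν'`.  This is where each route's IDENTIFICATION mechanism enters (conformal restriction +
  simplicity, LSW03; the corridor exponent `5/8`, this route; a discrete observable, sibling routes): any
  characterisation of the subsequential limits by data not depending on the subsequence proves (U).
  OPEN (it is "the LSW conjecture minus tightness minus the name of the limit").  Hypothesis shape = that
  of the vetted shared crux `SubseqIdentification` (stmt-0783), whose Disproof.lean shows `s → 0⁺`
  one-sided and both endpoint limits are load-bearing and `IsProbabilityMeasure` is harmless.
* `stub_confCovOfLimit` — (C) COVARIANCE OF THE LIMIT: every chordal family that IS the full scaling
  limit (lim) is conformally covariant (`ChordalFamily.IsConformallyCovariant`, literally the (conf)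
  clause).  Same shape as the owning route's `RestrictionOfLimit` / `SimpleOfLimit` ("∀ P, chordal →
  (lim) → property") and exactly the conclusion the upgrade items of sibling routes deliver
  (`SAWConePseudogroup.CovarianceUpgrade`, `SAWEdwardsStrongCoupling.CovarianceOfLimit`).  OPEN: on `ℤ²`
  no discrete-holomorphic observable is known; rotations of the lattice are the hard case
  (barriers `EmbeddingModulusUniqueness`, `ScaleCovarianceNotMoebius` bite HERE and only here).

`ConfCovLimit_of (hT : Registered.stub_eventualTight) (hU : Registered.stub_subseqLimitsAgree)
(hC : Registered.stub_confCovOfLimit) : SAWTowerCount.ConfCovLimit` is PROVED below (no sorry; the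
`Registered.stub_*` abbrevs are the stub statements keyed by stub name, the skeleton-check convention):
reference approximation `SAW.exists_isEndpointApprox`, reference sequence `1/(n+1)`, `P D :=` a probability
subsequential limit obtained from (T) by Prokhorov run on a surrogate family past the junk meshes
(`exists_subseqLimit`); chordality by the tree lemmas `ae_endpoints_of_hyps`,
`ae_range_subset_closure_of_hyps`; every subsequential limit of `D` equals `P D` by (U); full-filter
convergence by `Filter.tendsto_of_subseq_tendsto`; (conf) by (C) applied to the scaling-limit family `P`.
The same proof term closes the two sibling decls (`ConfCovLimit_of_confRestriction`; the
SAWBrownianDomination copy has the identical body and is not imported here only to keep the cone small).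

Sorries: exactly 3 = the three `stub_*`; zero elsewhere.  Disproof used: none (no `Disproof.lean` on this
crux).  Negatives honoured: stmt-0772 not used.  BC3 probes (planner folder `bc/probe_{T,U,C}_{crux,summit}.lean`):
for each stub, `stub → ConfCovLimit` and `stub → SAWScalingLimit` by
`first | exact? | simpa [Stub] | (unfold Stub; simpa) | aesop` FAIL.
-/

noncomputable section

open MeasureTheory Filter Topology Set Metric Function
open Literature.Probability.RandomPlanarGeometry Literature.Probability.RandomPlanarGeometry.SAW
open Literature.Probability.LatticeModels
open scoped ENNReal NNReal BoundedContinuousFunction MeasureTheory Topology ProbabilityTheory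

namespace Summit.CriticalPhenomena.SAWScalingLimit.Cruxes.ConfCovLimit.Birth

open Summit.CriticalPhenomena.SAWScalingLimit.Theorems.SubseqIdentification.Negative
  (eventually_isProbabilityMeasure_law isProbabilityMeasure_of_hyps ae_endpoints_of_hyps
    ae_range_subset_closure_of_hyps)

/-! ## The registered stubs -/

/-- **stub (T) — EVENTUAL TIGHTNESS ALONG THE MESH FILTER** (verbatim the shared item `EventualTight`,
stmt-CriticalPhenomena-1881, `SAWConfRestriction.EventualTight`): for every Dobrushin domain and endpoint
approximation and every `ε > 0` some compact set of `CurveClass ℂ` carries all but `ε` of the critical SAW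
law for all small `δ > 0` (`IsTightAlongMesh`, the form `convergesInLawToSLE_of_isTightAlongMesh` consumes).
OPEN: needs an annulus-crossing / no-macroscopic-oscillation bound for the critical SAW (Aizenman–Burchard
regularity; Kemppainen–Smirnov Condition G2 is verified for FKG models only).
Sources: KemppainenSmirnov2017 (arXiv:1212.6215) Thm 1.5, AizenmanBurchardDuke1999 Thm 1.1,
DuminilCopinHammond2013 (arXiv:1205.0401), LawlerSchrammWerner2004SAW (arXiv:math/0204277) §3.4.2. -/
theorem stub_eventualTight : ∀ (D : Literature.Probability.RandomPlanarGeometry.DobrushinDomain) (a b : ℝ → Literature.Probability.LatticeModels.Site 2), Literature.Probability.RandomPlanarGeometry.SAW.IsEndpointApprox D a b → Literature.Probability.RandomPlanarGeometry.IsTightAlongMesh (fun δ (γ : Literature.Probability.RandomPlanarGeometry.SAW.DomainSAW D.carrier δ (a δ) (b δ)) => γ.curve) (fun δ => Literature.Probability.RandomPlanarGeometry.SAW.law D.carrier δ (a δ) (b δ)) := by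
  sorry

/-- **stub (U) — SUBSEQUENTIAL LIMITS AGREE** (new; uniqueness of subsequential scaling limits across
endpoint approximations AND mesh sequences): for one Dobrushin domain `D`, two endpoint approximations
`(a, b)`, `(a', b')`, two mesh sequences `s, s' → 0⁺` and two probability measures `ν, ν'` that are the
weak limits (bounded continuous test functions of `γ.curve`) of the corresponding critical SAW laws,
`ν = ν'`.  The identification half of the existence problem: any subsequence-free characterisation of
the subsequential limits (restriction + simplicity via LSW03; corridor exponent 5/8 + restriction, route
SAWTowerCount; a discrete observable) proves it.  A CONSEQUENCE of the crux
(`subseqLimitsAgree_of_confCovLimit` below).  OPEN.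
Sources: LawlerSchrammWerner2004SAW (arXiv:math/0204277) §1, §3.4.2 and Prediction 1; DuminilCopinSmirnov2012
(arXiv:1109.1549) §6 proof of Thm 3.13; BillingsleyCPM1999 Thm 2.6; KennedyLawler2013 (arXiv:1109.3091)
p.11 (approximation dependence as the failure mode). -/
theorem stub_subseqLimitsAgree : ∀ (D : Literature.Probability.RandomPlanarGeometry.DobrushinDomain) (a b a' b' : ℝ → Literature.Probability.LatticeModels.Site 2), Literature.Probability.RandomPlanarGeometry.SAW.IsEndpointApprox D a b → Literature.Probability.RandomPlanarGeometry.SAW.IsEndpointApprox D a' b' → ∀ (s s' : ℕ → ℝ) (ν ν' : MeasureTheory.Measure (Literature.Probability.RandomPlanarGeometry.CurveClass ℂ)), Filter.Tendsto s Filter.atTop (nhdsWithin 0 (Set.Ioi 0)) → Filter.Tendsto s' Filter.atTop (nhdsWithin 0 (Set.Ioi 0)) → MeasureTheory.IsProbabilityMeasure ν → MeasureTheory.IsProbabilityMeasure ν' → (∀ f : BoundedContinuousFunction (Literature.Probability.RandomPlanarGeometry.CurveClass ℂ) ℝ, Filter.Tendsto (fun n => ∫ γ, f γ.curve ∂(Literature.Probability.RandomPlanarGeometry.SAW.law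 D.carrier (s n) (a (s n)) (b (s n)))) Filter.atTop (nhds (∫ x, f x ∂ν))) → (∀ f : BoundedContinuousFunction (Literature.Probability.RandomPlanarGeometry.CurveClass ℂ) ℝ, Filter.Tendsto (fun n => ∫ γ, f γ.curve ∂(Literature.Probability.RandomPlanarGeometry.SAW.law D.carrier (s' n) (a' (s' n)) (b' (s' n)))) Filter.atTop (nhds (∫ x, f x ∂ν'))) → ν = ν' := by
  sorry

/-- **stub (C) — CONFORMAL COVARIANCE OF THE FULL LIMIT** (new as an item; the (conf) half made
conditional on (lim)): every chordal family `P` that is the full scaling limit of the critical `δℤ²` SAW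
laws (every Dobrushin domain, every endpoint approximation) is conformally covariant —
`P D' = Φ_* (P D)` for every conformal equivalence `g : D → D'` with boundary values `a ↦ a'`, `b ↦ b'`
and every continuous `Φ` agreeing with `g` on `D` (`ChordalFamily.IsConformallyCovariant`, literally the
crux's (conf) clause, `ChordalFamily.isConformallyCovariant_iff`).  Same shape as the owning route's
`RestrictionOfLimit` / `SimpleOfLimit`; the conclusion the sibling upgrade items deliver
(`SAWConePseudogroup.CovarianceUpgrade`, `SAWEdwardsStrongCoupling.CovarianceOfLimit`).  A CONSEQUENCE of
the crux by uniqueness of the full limit (`confCovOfLimit_of_confCovLimit` below).  OPEN: on `ℤ²` no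
discrete-holomorphic observable; lattice rotations are the hard case (barriers EmbeddingModulusUniqueness,
ScaleCovarianceNotMoebius).
Sources: LawlerSchrammWerner2004SAW (arXiv:math/0204277) p.3 and §2; DuminilCopinSmirnov2012 Conj. 1;
Beffara2008Universal; KennedyLawler2013 (arXiv:1109.3091). -/
theorem stub_confCovOfLimit : ∀ P : Literature.Probability.RandomPlanarGeometry.ChordalFamily, P.IsChordal → (∀ (D : Literature.Probability.RandomPlanarGeometry.DobrushinDomain) (a b : ℝ → Literature.Probability.LatticeModels.Site 2), Literature.Probability.RandomPlanarGeometry.SAW.IsEndpointApprox D a b → Literature.Probability.RandomPlanarGeometry.TendstoLaw (fun δ (γ : Literature.Probability.RandomPlanarGeometry.SAW.DomainSAW D.carrier δ (a δ) (b δ)) => γ.curve) (fun δ => Literature.Probability.RandomPlanarGeometry.SAW.law D.carrier δ (a δ) (b δ)) id (P D)) → P.IsConformallyCovariant := by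
  sorry

/-! ## Name-keyed aliases of the stub statements (skeleton-check convention: the hypotheses of
`ConfCovLimit_of` are exactly the declared stubs, each BY NAME) -/

namespace Registered

/-- Alias keyed by the stub name: the statement of `stub_eventualTight` (= item stmt-1881 `EventualTight`). -/
abbrev stub_eventualTight : Prop :=
  ∀ (D : Literature.Probability.RandomPlanarGeometry.DobrushinDomain) (a b : ℝ → Literature.Probability.LatticeModels.Site 2), Literature.Probability.RandomPlanarGeometry.SAW.IsEndpointApprox D a b → Literature.Probability.RandomPlanarGeometry.IsTightAlongMesh (fun δ (γ : Literature.Probability.RandomPlanarGeometry.SAW.DomainSAW D.carrier δ (a δ) (b δ)) => γ.curve) (fun δ => Literature.Probability.RandomPlanarGeometry.SAW.law D.carrier δ (a δ) (b δ))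

/-- Alias keyed by the stub name: the statement of `stub_subseqLimitsAgree` (new). -/
abbrev stub_subseqLimitsAgree : Prop :=
  ∀ (D : Literature.Probability.RandomPlanarGeometry.DobrushinDomain) (a b a' b' : ℝ → Literature.Probability.LatticeModels.Site 2), Literature.Probability.RandomPlanarGeometry.SAW.IsEndpointApprox D a b → Literature.Probability.RandomPlanarGeometry.SAW.IsEndpointApprox D a' b' → ∀ (s s' : ℕ → ℝ) (ν ν' : MeasureTheory.Measure (Literature.Probability.RandomPlanarGeometry.CurveClass ℂ)), Filter.Tendsto s Filter.atTop (nhdsWithin 0 (Set.Ioi 0)) → Filter.Tendsto s' Filter.atTop (nhdsWithin 0 (Set.Ioi 0)) → MeasureTheory.IsProbabilityMeasure ν → MeasureTheory.IsProbabilityMeasure ν' → (∀ f : BoundedContinuousFunction (Literature.Probability.RandomPlanarGeometry.CurveClass ℂ) ℝ, Filter.Tendsto (fun n => ∫ γ, f γ.curve ∂(Literature.Probability.RandomPlanarGeometry.SAW.law D.carrier (s n) (a (s n)) (b (s n)))) Filter.atTop (nhds (∫ x, f x ∂ν))) → (∀ f : BoundedContinuousFunction (Literature.Probability.RandomPlanarGeometry.CurveClass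 ℂ) ℝ, Filter.Tendsto (fun n => ∫ γ, f γ.curve ∂(Literature.Probability.RandomPlanarGeometry.SAW.law D.carrier (s' n) (a' (s' n)) (b' (s' n)))) Filter.atTop (nhds (∫ x, f x ∂ν'))) → ν = ν'

/-- Alias keyed by the stub name: the statement of `stub_confCovOfLimit` (new). -/
abbrev stub_confCovOfLimit : Prop :=
  ∀ P : Literature.Probability.RandomPlanarGeometry.ChordalFamily, P.IsChordal → (∀ (D : Literature.Probability.RandomPlanarGeometry.DobrushinDomain) (a b : ℝ → Literature.Probability.LatticeModels.Site 2), Literature.Probability.RandomPlanarGeometry.SAW.IsEndpointApprox D a b → Literature.Probability.RandomPlanarGeometry.TendstoLaw (fun δ (γ : Literature.Probability.RandomPlanarGeometry.SAW.DomainSAW D.carrier δ (a δ) (b δ)) => γ.curve) (fun δ => Literature.Probability.RandomPlanarGeometry.SAW.law D.carrier δ (a δ) (b δ)) id (P D)) → P.IsConformallyCovariant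

end Registered

/-! ## Reformulation of the crux through the tree's named predicates -/

/-- The crux is "a conformally covariant scaling-limit family exists" (`SAW.IsScalingLimitFamily` bundles
chordality with (lim); `ChordalFamily.IsConformallyCovariant` is literally (conf)). [folklore] -/
theorem confCovLimit_iff_family :
    Summit.CriticalPhenomena.SAWScalingLimit.Theses.SAWTowerCount.ConfCovLimit ↔
      ∃ P : ChordalFamily, SAW.IsScalingLimitFamily P ∧ P.IsConformallyCovariant := by
  constructor
  · rintro ⟨P, h1, h2, h3⟩
    exact ⟨P, ⟨h1, h2⟩, h3⟩
  · rintro ⟨P, ⟨h1, h2⟩, h3⟩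
    exact ⟨P, h1, h2, h3⟩

/-- (C) in bundled form: every scaling-limit family is conformally covariant. [folklore] -/
theorem stub_confCovOfLimit_iff_family :
    Registered.stub_confCovOfLimit ↔
      ∀ P : ChordalFamily, SAW.IsScalingLimitFamily P → P.IsConformallyCovariant :=
  ⟨fun h P hP => h P hP.1 hP.2, fun h P h1 h2 => h P ⟨h1, h2⟩⟩

/-! ## Proved glue: Prokhorov past the junk meshes -/

/-- **Subsequential limits exist under eventual tightness along the mesh.**  If the critical SAW curves
are tight along `𝓝[>] 0` (stub (T) for one `(D, a, b)`), then along every mesh sequence `sₙ → 0⁺` some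
subsequence converges weakly (bounded continuous test functions of `γ.curve`) to a probability measure.
The SAW law is a probability measure only for small `δ` (junk value `0` when `a_δ, b_δ` are not joined),
so `IsTightAlongMesh.exists_subseq` (which wants probability laws at EVERY mesh) is run on the surrogate
family "push-forward law if it is a probability measure, else a Dirac mass" on the curve space, which
agrees with the push-forward laws on a germ at `0⁺` (`eventually_isProbabilityMeasure_law`).
[cite: BillingsleyCPM1999, Thm. 5.1] -/
theorem exists_subseqLimit {D : DobrushinDomain} {a b : ℝ → Site 2} (hab : SAW.IsEndpointApprox D a b)
    (htight : IsTightAlongMesh (fun δ (γ : DomainSAW D.carrier δ (a δ) (b δ)) => γ.curve)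
      (fun δ => SAW.law D.carrier δ (a δ) (b δ)))
    {s : ℕ → ℝ} (hs : Tendsto s atTop (𝓝[>] (0 : ℝ))) :
    ∃ (φ : ℕ → ℕ) (ν : Measure (CurveClass ℂ)), StrictMono φ ∧ IsProbabilityMeasure ν ∧
      ∀ f : CurveClass ℂ →ᵇ ℝ, Tendsto (fun n => ∫ γ, f γ.curve
        ∂(SAW.law D.carrier (s (φ n)) (a (s (φ n))) (b (s (φ n))))) atTop (𝓝 (∫ x, f x ∂ν)) := by
  classical
  -- the push-forward laws and the surrogate family of probability laws on the curve space
  obtain ⟨L, hL⟩ : ∃ L : ℝ → Measure (CurveClass ℂ), ∀ δ, L δ =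
      (SAW.law D.carrier δ (a δ) (b δ)).map (fun γ => γ.curve) := ⟨_, fun _ => rfl⟩
  obtain ⟨μ, hμ⟩ : ∃ μ : ℝ → Measure (CurveClass ℂ), ∀ δ, μ δ =
      if IsProbabilityMeasure (L δ) then L δ
      else Measure.dirac (CurveClass.mk (Curve.const 0)) := ⟨_, fun _ => rfl⟩
  have hμprob : ∀ δ, IsProbabilityMeasure (μ δ) := by
    intro δ
    by_cases h : IsProbabilityMeasure (L δ)
    · rw [hμ δ, if_pos h]; exact h
    · rw [hμ δ, if_neg h]; infer_instance
  -- for all small `δ` the surrogate IS the push-forward law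
  have hev : ∀ᶠ δ in 𝓝[>] (0 : ℝ), μ δ = L δ := by
    filter_upwards [eventually_isProbabilityMeasure_law hab] with δ hδ
    haveI := hδ
    have hp : IsProbabilityMeasure (L δ) := by
      rw [hL δ]
      exact Measure.isProbabilityMeasure_map (SAW.aemeasurable_curve _ _ _ _)
    rw [hμ δ, if_pos hp]
  -- tightness along the mesh of the surrogate family, observed through the identity
  have hT : IsTightAlongMesh (Ωδ := fun _ : ℝ => CurveClass ℂ)
      (fun (_ : ℝ) (x : CurveClass ℂ) => x) μ := by
    intro ε hε
    obtain ⟨K, hK, hbK⟩ := htight ε hε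
    refine ⟨K, hK, ?_⟩
    filter_upwards [hev, hbK] with δ hδ hδK
    show μ δ Kᶜ ≤ ε
    rw [hδ, hL δ, Measure.map_apply (DomainSAW.measurable_of_top _)
      hK.isClosed.isOpen_compl.measurableSet]
    exact hδK
  haveI : ∀ δ, IsProbabilityMeasure (μ δ) := hμprob
  obtain ⟨φ, ν, hφ, hν, hlim⟩ :=
    hT.exists_subseq (Filter.Eventually.of_forall fun δ => aemeasurable_id') hs
  refine ⟨φ, ν, hφ, hν, fun f => ?_⟩
  have hs' : Tendsto (fun n => s (φ n)) atTop (𝓝[>] (0 : ℝ)) := hs.comp hφ.tendsto_atTop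
  refine (hlim f).congr' ?_
  filter_upwards [hs'.eventually hev] with n hn
  have hn' : μ (s (φ n)) = L (s (φ n)) := hn
  show ∫ x, f x ∂(μ (s (φ n))) = ∫ γ, f γ.curve ∂(SAW.law D.carrier (s (φ n)) (a (s (φ n))) (b (s (φ n))))
  rw [hn', hL]
  exact integral_map (SAW.aemeasurable_curve _ _ _ _) f.continuous.aestronglyMeasurable

/-! ## The composition: the crux BY NAME from the three stubs -/

/-- **Existence of the scaling-limit family from (T) and (U)** (the `LimitExists` half).  For each Dobrushin
domain `D` pick an endpoint approximation (`SAW.exists_isEndpointApprox`), the mesh sequence `1/(n+1)`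
and, by (T) + `exists_subseqLimit`, a probability subsequential limit `P D`.  It is chordal (tree:
`ae_endpoints_of_hyps`, `ae_range_subset_closure_of_hyps`).  Every probability subsequential limit `ν` of
`D`, along ANY approximation and sequence, equals `P D` by (U).  Then `Filter.tendsto_of_subseq_tendsto`
along the countably generated filter `𝓝[>] 0` gives `TendstoLaw` for every approximation.
[cite: BillingsleyCPM1999, Thm. 2.6 and Thm. 5.1 Corollary] -/
theorem exists_isScalingLimitFamily (hT : Registered.stub_eventualTight)
    (hU : Registered.stub_subseqLimitsAgree) :
    ∃ P : ChordalFamily, SAW.IsScalingLimitFamily P := by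
  classical
  -- the reference mesh sequence `1/(n+1) → 0⁺`
  have hs₁ : Tendsto (fun n : ℕ => 1 / ((n : ℝ) + 1)) atTop (𝓝[>] (0 : ℝ)) :=
    tendsto_nhdsWithin_iff.2 ⟨tendsto_one_div_add_atTop_nhds_zero_nat,
      Filter.Eventually.of_forall fun n => Set.mem_Ioi.2 Nat.one_div_pos_of_nat⟩
  -- per domain: a reference approximation, sequence and probability subsequential limit
  have key : ∀ D : DobrushinDomain, ∃ (a b : ℝ → Site 2) (s : ℕ → ℝ) (ν : Measure (CurveClass ℂ)),
      SAW.IsEndpointApprox D a b ∧ Tendsto s atTop (𝓝[>] (0 : ℝ)) ∧ IsProbabilityMeasure ν ∧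
      ∀ f : CurveClass ℂ →ᵇ ℝ, Tendsto (fun n => ∫ γ, f γ.curve
        ∂(SAW.law D.carrier (s n) (a (s n)) (b (s n)))) atTop (𝓝 (∫ x, f x ∂ν)) := by
    intro D
    obtain ⟨a, b, hab⟩ := SAW.exists_isEndpointApprox D
    obtain ⟨φ, ν, hφ, hν, hlim⟩ := exists_subseqLimit hab (hT D a b hab) hs₁
    exact ⟨a, b, fun n => 1 / (((φ n : ℕ) : ℝ) + 1), ν, hab, hs₁.comp hφ.tendsto_atTop, hν, hlim⟩
  choose a₀ b₀ s₀ P hab₀ hs₀ hP hlim₀ using key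
  -- uniqueness of subsequential limits: (U) against the reference data
  have huniq : ∀ (D : DobrushinDomain) (a b : ℝ → Site 2), SAW.IsEndpointApprox D a b →
      ∀ (s : ℕ → ℝ) (ν : Measure (CurveClass ℂ)), Tendsto s atTop (𝓝[>] (0 : ℝ)) →
      IsProbabilityMeasure ν →
      (∀ f : CurveClass ℂ →ᵇ ℝ, Tendsto (fun n => ∫ γ, f γ.curve
        ∂(SAW.law D.carrier (s n) (a (s n)) (b (s n)))) atTop (𝓝 (∫ x, f x ∂ν))) → ν = P D := by
    intro D a b hab s ν hs hν hlim
    exact hU D a b (a₀ D) (b₀ D) hab (hab₀ D) s (s₀ D) ν (P D) hs (hs₀ D) hν (hP D) hlim (hlim₀ D)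
  refine ⟨P, fun D => ⟨hP D, ?_⟩, fun D a b hab f => ?_⟩
  · -- chordal: endpoints and confinement of the reference subsequential limit (tree lemmas)
    haveI := hP D
    filter_upwards [ae_endpoints_of_hyps (hab₀ D) (hs₀ D) (hlim₀ D),
      ae_range_subset_closure_of_hyps (hab₀ D) (hs₀ D) (hlim₀ D)] with γ h1 h2
    exact ⟨h1.1, h1.2, h2⟩
  · -- convergence along the full filter `𝓝[>] 0`: the subsequence principle
    refine tendsto_of_subseq_tendsto fun ns hns => ?_
    obtain ⟨φ, ν, hφ, hν, hlim⟩ := exists_subseqLimit hab (hT D a b hab) hns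
    have hν' : ν = P D :=
      huniq D a b hab (fun n => ns (φ n)) ν (hns.comp hφ.tendsto_atTop) hν hlim
    refine ⟨φ, ?_⟩
    have h := hlim f
    rw [hν'] at h
    simpa only [id_eq] using h

/-- **`ConfCovLimit` from (T), (U), (C)**: the scaling-limit family of `exists_isScalingLimitFamily`
is conformally covariant by (C); unbundle. [cite: LawlerSchrammWerner2004SAW, §3.4.2 and §2] -/
theorem ConfCovLimit_of (hT : Registered.stub_eventualTight) (hU : Registered.stub_subseqLimitsAgree)
    (hC : Registered.stub_confCovOfLimit) :
    Summit.CriticalPhenomena.SAWScalingLimit.Theses.SAWTowerCount.ConfCovLimit := by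
  obtain ⟨P, hP⟩ := exists_isScalingLimitFamily hT hU
  exact ⟨P, hP.isChordal, fun D a b hab => hP.tendstoLaw hab,
    (ChordalFamily.isConformallyCovariant_iff P).1 (hC P hP.isChordal fun D a b hab => hP.tendstoLaw hab)⟩

/-- Wiring check: the crux BY NAME from the three registered (sorried) stubs — shows the stub theorems
are exactly the hypotheses of `ConfCovLimit_of` (this declaration inherits their `sorry`; nothing is claimed). -/
theorem ConfCovLimit_wiring :
    Summit.CriticalPhenomena.SAWScalingLimit.Theses.SAWTowerCount.ConfCovLimit :=
  ConfCovLimit_of stub_eventualTight stub_subseqLimitsAgree stub_confCovOfLimit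

/-- The same composition closes the primary owner's copy of the shared crux
(`SAWConfRestriction.ConfCovLimit`, stmt-0771 rank 2; identical body). -/
theorem ConfCovLimit_of_confRestriction (hT : Registered.stub_eventualTight)
    (hU : Registered.stub_subseqLimitsAgree) (hC : Registered.stub_confCovOfLimit) :
    Summit.CriticalPhenomena.SAWScalingLimit.Theses.SAWConfRestriction.ConfCovLimit :=
  ConfCovLimit_of hT hU hC

/-! ## Pins (documentation): (T) IS the shared item; (U), (C) are consequences of the crux -/

/-- (T) is verbatim the shared item `SAWConfRestriction.EventualTight` (stmt-CriticalPhenomena-1881). -/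
theorem stub_eventualTight_iff_item1881 :
    Registered.stub_eventualTight ↔
      Summit.CriticalPhenomena.SAWScalingLimit.Theses.SAWConfRestriction.EventualTight :=
  Iff.rfl

/-- Sanity (necessity of (U)): under the crux every probability subsequential limit of `D` equals `P D`
(weak limits of probability measures are unique), so any two agree — (U) is a CONSEQUENCE of
`ConfCovLimit`. [folklore] -/
theorem subseqLimitsAgree_of_confCovLimit
    (h : Summit.CriticalPhenomena.SAWScalingLimit.Theses.SAWTowerCount.ConfCovLimit) :
    Registered.stub_subseqLimitsAgree := by
  obtain ⟨P, hPch, hPlim, -⟩ := h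
  intro D a b a' b' hab hab' s s' ν ν' hs hs' hν hν' hlim hlim'
  -- both subsequential limits equal `P D`
  have key : ∀ {a b : ℝ → Site 2} {s : ℕ → ℝ} {ν : Measure (CurveClass ℂ)},
      SAW.IsEndpointApprox D a b → Tendsto s atTop (𝓝[>] (0 : ℝ)) → IsProbabilityMeasure ν →
      (∀ f : CurveClass ℂ →ᵇ ℝ, Tendsto (fun n => ∫ γ, f γ.curve
        ∂(SAW.law D.carrier (s n) (a (s n)) (b (s n)))) atTop (𝓝 (∫ x, f x ∂ν))) → ν = P D := by
    intro a b s ν hab hs hν hlim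
    haveI := (hPch D).1
    haveI := hν
    refine ext_of_forall_integral_eq_of_IsFiniteMeasure fun f => ?_
    have h1 := hlim f
    have h2 : Tendsto (fun n => ∫ γ, f γ.curve ∂(SAW.law D.carrier (s n) (a (s n)) (b (s n))))
        atTop (𝓝 (∫ x, f x ∂(P D))) := by
      have := (hPlim D a b hab f).comp hs
      simpa only [id_eq, Function.comp_def] using this
    exact tendsto_nhds_unique h1 h2
  rw [key hab hs hν hlim, key hab' hs' hν' hlim']

/-- Sanity (necessity of (C)): under the crux the scaling-limit family is unique
(`SAW.IsScalingLimitFamily.unique`), so every scaling-limit family is the covariant one — (C) is a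
CONSEQUENCE of `ConfCovLimit`. [folklore] -/
theorem confCovOfLimit_of_confCovLimit
    (h : Summit.CriticalPhenomena.SAWScalingLimit.Theses.SAWTowerCount.ConfCovLimit) :
    Registered.stub_confCovOfLimit := by
  obtain ⟨P₀, hch, hlim, hconf⟩ := h
  intro P hPch hPlim
  have h₀ : SAW.IsScalingLimitFamily P₀ := ⟨hch, hlim⟩
  have hP : SAW.IsScalingLimitFamily P := ⟨hPch, hPlim⟩
  rw [hP.unique h₀]
  exact (ChordalFamily.isConformallyCovariant_iff P₀).2 hconf

/-- Sanity (the split is lossless): the crux is EQUIVALENT to "(T)-free existence" plus (C) — i.e.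
`ConfCovLimit ↔ (∃ P, SAW.IsScalingLimitFamily P) ∧ stub_confCovOfLimit`; (T) and (U) are the two halves
of the existence clause (Billingsley: precompactness + uniqueness of subsequential limits). [folklore] -/
theorem confCovLimit_iff_exists_and_cov :
    Summit.CriticalPhenomena.SAWScalingLimit.Theses.SAWTowerCount.ConfCovLimit ↔
      (∃ P : ChordalFamily, SAW.IsScalingLimitFamily P) ∧ Registered.stub_confCovOfLimit := by
  constructor
  · intro h
    refine ⟨?_, confCovOfLimit_of_confCovLimit h⟩
    obtain ⟨P, hch, hlim, -⟩ := h
    exact ⟨P, hch, hlim⟩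
  · rintro ⟨⟨P, hP⟩, hC⟩
    exact ⟨P, hP.isChordal, fun D a b hab => hP.tendstoLaw hab,
      (ChordalFamily.isConformallyCovariant_iff P).1
        (hC P hP.isChordal fun D a b hab => hP.tendstoLaw hab)⟩

end Summit.CriticalPhenomena.SAWScalingLimit.Cruxes.ConfCovLimit.Birth
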